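import Mathlib
import HarnessLib
import Literature.Computability.AlgebraicComplexity.SmallTensorBorderRankTight4Part10
import Literature.Computability.AlgebraicComplexity.BorderRankRestriction
import Literature.Computability.AlgebraicComplexity.BorderRankFlattening
import Literature.Computability.AlgebraicComplexity.SchoenhageTau
import Literature.Computability.AlgebraicComplexity.PrattTripartitionBoundsProofs
import Summits.MatrixMultiplication.MatrixMultiplication.Theorems.OutsiderSandwichBlockNormalForm
import Summits.MatrixMultiplication.MatrixMultiplication.Theorems.OutsiderSandwichBlockRank

/-!
# OutsiderSandwich — rank and border rank of the coupled block `C₁` (decomp-mm lens-4, g17)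

The one tensor the block descent localises the summit to (`Theorems/OutsiderSandwichBlockOne.lean`,
`ω = 2 ⟺ BlockOneIsMM ∧ CouplingMergeOptimal`) is the `4 × 4 × 4` coupled block
`C₁ = T^{[211]}(cw₂^{⊗2})`, the structure tensor of `(X; u, w) ↦ (Xw, uᵀX)` on `M₂(ℂ) × (ℂ² ⊕ ℂ²)`
(versus `⟨2,2,2⟩ = (X; u, w) ↦ (Xu, Xw)`).  This file pins down its classical invariants:

* `coupling₁_eq_ofEntries` — the integer entry table of `C₁` (8 ones);
* `C1_check`, `tensorRank_coupling₁_le : R(C₁) ≤ 7` — an explicit SEVEN-product algorithm for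
  `(Xw, uᵀX)`: `p₁ = a(u₁+w₁)`, `p₂ = d(u₂+w₂)`, `p₃ = b(u₁+w₂)`, `p₄ = c(u₂+w₁)`, `p₅ = (a+b)u₁`,
  `p₆ = (b+d)w₂`, `p₇ = (a+c)w₁` (`X = [[a,b],[c,d]]`), `Xw = (p₁+p₃−p₅, −p₁−p₃+p₅+p₆+p₇)`,
  `uᵀX = (p₁+p₄−p₇, p₂+p₃−p₆)`, checked in the kernel as an order-`0` decomposition certificate;
* `coupling₁_eq_T4_512`, `algBorderRank_coupling₁ : R̲(C₁) = 6` — `C₁` is, up to a rotation of the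
  legs and the half-swap of one index set, the all-ones tensor of tight support class `T4-512` of
  `[4]³`, whose border rank `6` is certified in `Literature/…/SmallTensorBorderRankTight4Part10.lean`
  (`SmallTensorBorderRank.algBorderRank_T4_512`: approximate decomposition + Koszul–Young flattening);
  for comparison `⟨2,2,2⟩` is class `T4-511` with `R̲ = R = 7`;
* `six_le_tensorRank_coupling₁ : 6 ≤ R(C₁)`, `asymptoticRank_coupling₁_le_seven : R̃(C₁) ≤ 7`, and
  the summary `asymptoticRank_coupling₁_mem : R̃(C₁) ∈ [4, 7]`.
-/

set_option Elab.async false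

noncomputable section

namespace Summit.MatrixMultiplication.MatrixMultiplication.Theorems.OutsiderSandwichBlockOneRank

open Literature.Computability.AlgebraicComplexity
open Summit.MatrixMultiplication.MatrixMultiplication.Theorems.OutsiderSandwichCoupling
open Summit.MatrixMultiplication.MatrixMultiplication.Theorems.OutsiderSandwichBlockNormalForm
  (blockOneSupp coupling₁_apply)

/-! ## 1. The entry table of `C₁` -/

/-- The integer entry table of `C₁`: ones at `(x_{(r,s)}, u_s, (uᵀX)_r) = (2r+s, s, 2+r)` and
`(x_{(r,s)}, w_r, (Xw)_s) = (2r+s, 2+r, s)`. -/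
def entriesC₁ : Fin 4 → Fin 4 → Fin 4 → ℤ :=
  ApproxCert.ofEntries 4 4 4 [((0, 0, 2), 1), ((0, 2, 0), 1), ((1, 1, 2), 1), ((1, 2, 1), 1),
    ((2, 0, 3), 1), ((2, 3, 0), 1), ((3, 1, 3), 1), ((3, 3, 1), 1)]

/-- The table agrees with the support predicate of `C₁`. -/
theorem entriesC₁_apply : ∀ a b c : Fin 4, entriesC₁ a b c = if blockOneSupp a b c then 1 else 0 := by
  decide

/-- **`C₁` is the cast of its integer entry table.** -/
theorem coupling₁_eq_ofEntries : coupling₁ = fun a b c => ((entriesC₁ a b c : ℤ) : ℂ) := by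
  funext a b c
  rw [coupling₁_apply, entriesC₁_apply a b c]
  split_ifs <;> simp

/-! ## 2. `R(C₁) ≤ 7`: a seven-product algorithm for `(Xw, uᵀX)` -/

/-- Order-`0` decomposition certificate of `C₁` with `7` triads and multiplier `1` (the seven
products `p₁, …, p₇` of the module docstring), checked in the kernel. -/
theorem C1_check :
    ApproxCert.check 4 4 4 7 0 1 entriesC₁
      ![![[1], [], [], []], ![[], [], [], [1]], ![[], [], [1], []], ![[], [1], [], []],
        ![[1], [], [1], []], ![[], [], [1], [1]], ![[1], [1], [], []]]
      ![![[1], [], [1], []], ![[], [1], [], [1]], ![[1], [], [], [1]], ![[], [1], [1], []],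
        ![[1], [], [], []], ![[], [], [], [1]], ![[], [], [1], []]]
      ![![[1], [-1], [1], []], ![[], [], [], [1]], ![[1], [-1], [], [1]], ![[], [], [1], []],
        ![[-1], [1], [], []], ![[], [1], [], [-1]], ![[], [1], [-1], []]] = true := by
  decide +kernel

/-- **`R(C₁) ≤ 7`.** -/
theorem tensorRank_coupling₁_le : tensorRank coupling₁ ≤ 7 := by
  rw [coupling₁_eq_ofEntries]
  exact ApproxCert.tensorRank_le_of_check_one ℂ C1_check

/-- **`R̃(C₁) ≤ 7`.** -/
theorem asymptoticRank_coupling₁_le_seven : asymptoticRank coupling₁ ≤ 7 :=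
  (asymptoticRank_le_tensorRank coupling₁).trans (by exact_mod_cast tensorRank_coupling₁_le)

/-! ## 3. `R̲(C₁) = 6`: `C₁` is tight support class `T4-512` -/

/-- The all-ones tensor of tight support class `T4-512` of `[4]³` (integer table, as in the census
file `SmallTensorBorderRankTight4Part10`). -/
def entriesT512 : Fin 4 → Fin 4 → Fin 4 → ℤ :=
  ApproxCert.ofEntries 4 4 4 [((0, 0, 0), 1), ((0, 1, 1), 1), ((1, 0, 2), 1), ((1, 1, 3), 1),
    ((2, 2, 0), 1), ((2, 3, 2), 1), ((3, 2, 1), 1), ((3, 3, 3), 1)]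

/-- The half-swap `(0 2)(1 3)` of `Fin 4`. -/
def halfSwap : Fin 4 ≃ Fin 4 := (Equiv.swap 0 2).trans (Equiv.swap 1 3)

/-- Entrywise: `C₁(a,b,c) = T4-512(halfSwap b, c, a)`. -/
theorem entriesC₁_eq_T512 : ∀ a b c : Fin 4, entriesC₁ a b c = entriesT512 (halfSwap b) c a := by
  decide

/-- **`C₁ ≅ T4-512`**: `C₁` is the double rotation of the first-leg relabelling of `T4-512`. -/
theorem coupling₁_eq_T4_512 :
    coupling₁ = rotate (rotate (fun x y z => ((entriesT512 (halfSwap x) y z : ℤ) : ℂ))) := by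
  rw [coupling₁_eq_ofEntries]
  funext a b c
  simp only [rotate, entriesC₁_eq_T512 a b c]

/-- **`R̲(C₁) = 6`** (border rank over `ℂ`; class `T4-512` of the tight-`[4]³` census). -/
theorem algBorderRank_coupling₁ : algBorderRank coupling₁ = 6 := by
  rw [coupling₁_eq_T4_512, algBorderRank_rotate, algBorderRank_rotate]
  have h := algBorderRank_reindex halfSwap (Equiv.refl (Fin 4)) (Equiv.refl (Fin 4))
    (fun x y z => ((entriesT512 x y z : ℤ) : ℂ))
  simp only [Equiv.refl_apply] at h
  rw [h]
  exact SmallTensorBorderRank.algBorderRank_T4_512 ℂ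

/-- **`6 ≤ R(C₁)`.** -/
theorem six_le_tensorRank_coupling₁ : 6 ≤ tensorRank coupling₁ :=
  algBorderRank_coupling₁.symm.le.trans (algBorderRank_le_tensorRank coupling₁)

/-- Summary: `R̲(C₁) = 6 ≤ R(C₁) ≤ 7` and `4 = Q̃(C₁) ≤ R̃(C₁) ≤ 7`. -/
theorem asymptoticRank_coupling₁_mem :
    algBorderRank coupling₁ = 6 ∧ 6 ≤ tensorRank coupling₁ ∧ tensorRank coupling₁ ≤ 7 ∧
      (4 : ℝ) ≤ asymptoticRank coupling₁ ∧ asymptoticRank coupling₁ ≤ 7 :=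
  ⟨algBorderRank_coupling₁, six_le_tensorRank_coupling₁, tensorRank_coupling₁_le,
    OutsiderSandwichBlockRank.four_le_asymptoticRank_coupling₁, asymptoticRank_coupling₁_le_seven⟩

end Summit.MatrixMultiplication.MatrixMultiplication.Theorems.OutsiderSandwichBlockOneRank
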